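import Summits.QuantumFields.QCD.Theses.FemtoStepScaling
import HarnessLib.Audit

/-!
# Birth skeleton (BC3) for the crux `SharpChiralEdge` (item stmt-QuantumFields-17667)

Route `FemtoStepScaling` (sub-problem QCD), crux decl
`Summit.QuantumFields.QCD.Theses.FemtoStepScaling.SharpChiralEdge` (rank 7, NEW at rev 3 of the route after
the statement re-type p117723).  Registered by the skeleton-registrar seat `planner-skel-stmt-QuantumFields-17667-0`
(route re-audit bin REPAIRABLE, 2026-08-17) as `Cruxes/SharpChiralEdge/Lines/birth.lean`: three named stubs, a
kernel-checked composition `SharpChiralEdge_of` concluding the crux BY NAME, `sorry` only inside `stub_*`.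

## The crux, folded (§0, `sharpChiralEdge_iff` is `Iff.rfl`)

With `Mixes reg m := ∀ ε > 0, ∃ ℓ > 0, MixAt reg m ε ℓ` (the crux's inner clause verbatim: eventually in `k`, on the
hypercubic torus of side `2⌊ℓ/2a_k⌋+1`, the `(−1)^F`-twisted partition function is `≠ 0` and the sup-normalised
time-slab covariance of all bounded gluonic cylinder observables across half the box is `≤ ε`),
`InT reg M := ∀ m, (∀ fl, M < m fl) → Mixes reg m` ("`M` is a mixing threshold") and
`GaplessAbove reg M := ∀ ε > 0, ∃ m, (∀ fl, M < m fl) ∧ ¬ (reg.scheme m 0 0).HasLatticeMassGap ε`, the crux reads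

  `∀ Nf reg, 2 ≤ Nf → Nf ≤ 3 → Good Nf reg → reg.IsChiralAtZero → (∃ M₀, InT reg M₀) →
     ∃ Mχ ≥ 0, InT reg Mχ ∧ GaplessAbove reg Mχ`,

and `reg.IsChiralAtZero` is `GaplessAbove reg 0` by `Iff.rfl`.  The set `T = {M | InT reg M}` of thresholds is an
UP-SET of `ℝ` which contains its infimum when bounded below (§3, pure order theory: a tuple strictly above `inf T` is
strictly above some element of `T`).  Hence (§4) EITHER every positive level is a threshold — then `Mχ := 0` works,
the Statement's own chiral clause being the gapless edge — OR `T = [M⋆, ∞)` with `M⋆ > 0` (non-empty by the ladder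
hypothesis `∃ M₀`, which is therefore load-bearing), and the crux holds with `Mχ := M⋆` as soon as `M⋆` is gapless from
above.  So the whole content of the crux is

  NO GAPPED WALL: a level `M > 0` above which the lattice gap is UNIFORM lies STRICTLY inside the mixing region
  (`∃ M' < M, InT reg M'`),

and the skeleton cuts THAT along the three different mechanisms it takes (none is bookkeeping, none is the crux):

* `stub_gapDrivesMixing : GapDrivesMixingStmt` — THE DICTIONARY, gap ⇒ mixing (size L).  A uniform lattice gap `δ`
  on the orthant above a level `M ≥ 0` drives box mixing to every precision `ε` at ONE physical scale `ℓ(δ, ε)` common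
  to all tuples of the orthant.  Spectral mechanism: vacuum-to-vacuum term `≤ e^{−δ·3ℓ/8}` with NO entropy factor,
  `(−1)^F`-thermal corrections controlled by the density of states of a gapped theory in the box `ℓ³`, twisted
  partition function `≠ 0` by vacuum dominance.  Why it might fail / what it costs: `HasLatticeMassGap` lives on the
  tori `S ≥ L_k` (physical size → ∞), the conclusion on the torus of FIXED physical side `ℓ` — a cutoff-uniform
  Lüscher-type finite-volume transfer for Wilson quarks under a signed determinant is not in print.
* `stub_fixedScaleOpenness : FixedScaleOpennessStmt` — MASS CONTINUITY AT FIXED SCALE (size M/L).  Inside the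
  uniformly gapped regime, box mixing at a FIXED scale `ℓ` with margin `ε/2` on the orthant above `M > 0` persists
  with precision `ε` on the orthant above some `M' < M`.  Mechanism: `k`-uniform equicontinuity in the RENORMALISED
  mass of finite-volume twisted expectations (Feynman–Hellmann: mass derivatives are volume-integrated insertions of
  the renormalised scalar density, `Z_S Z_m = 1` — exactly why the bare trajectory carries `a_k/Z_m(k)`).  This stub
  carries the crux's own bet "no non-chiral obstruction": a FIRST-ORDER WALL in `m` inside the massive regime (phase
  coexistence in the `ℓ`-box at the wall tuple) refutes it — the route header's kill criterion for this crux.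
* `stub_thresholdBootstrap : ThresholdBootstrapStmt` — FINITE-SIZE BOOTSTRAP (size XL / open).  There is a threshold
  `ε₀(reg) > 0` such that box mixing below `ε₀` at ONE physical scale forces box mixing to decay (every `ε` at some
  scale) — Dobrushin–Shlosman / Martinelli–Olivieri shape, cutoff-uniform; at a gapless (scale-invariant) tuple the
  sup-normalised slab covariance is scale-independent and `≥ ε₀`, so the hypothesis never starts there.  Same
  technology as the route's rank-3 crux `PhysicalFiniteSizeCriterionR` (threshold mixing ⇒ gluonic gap on all larger
  tori), here closed up with the dictionary.

`SharpChiralEdge_of : GapDrivesMixingStmt → FixedScaleOpennessStmt → ThresholdBootstrapStmt → SharpChiralEdge`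
(§4) is kernel-checked: `noGappedWall_of` chains the three stubs (dictionary at precision `ε₀/2` ⇒ openness at
precision `ε₀` ⇒ bootstrap on the positive part of the new orthant), then the order argument above.  Each stub alone
is idle: the dictionary alone only re-proves `M ∈ T`; openness alone has no common scale to act on; the bootstrap alone
has no input — and none implies `QCD` (BC3 probes, `Lines/birth.md`).

## Negative knowledge honoured (read 2026-08-17)
* `Cruxes/SharpChiralEdge/` had no workfiles (no `Disproof.lean`, no Ideas, no Lines) — `ledger crux ls`.
* Grounder g71-1 (item note, 2026-08-16): "(a)+(b) assert exactly the SHARPNESS of the lower edge of the decaying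
  orthant; not a formal consequence of IsChiralAtZero + BoxMixingDecayR" — §4 is that remark made precise: the edge
  `inf T` exists and is attained for free, sharpness = `NoGappedWall`.
* `ledger negatives --problem QuantumFields` (5 entries: RobustYangMillsRG 14958, MirrorModularBoosts 9665,
  AdaptiveCoarseSystem 9494, MultibosonLatticeGap 9599, AdmissibleRootsExist 9603): none concerns box mixing, the
  chiral edge or `HasLatticeMassGap` along a regularisation; no stub restates one.
* Barriers: `Literature.Barriers.QuantumFields.AokiPhaseDichotomy` (Sharpe–Singleton: Aoki fingers / first-order
  jump at `κ_c`) is the named failure mode of `stub_fixedScaleOpenness` only if the structure has PHYSICAL width —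
  both scenarios give `m_π^min → 0` in physical units, and the stub is only ever invoked at levels above which the gap
  is uniform, i.e. strictly above the chiral point of `reg`; `VafaWittenEigenvalueBound` (no volume-uniform Dirac gap)
  is not used by any stub (no Dirac-spectrum hypothesis appears).
-/

noncomputable section

namespace Summit.QuantumFields.QCD.Cruxes.SharpChiralEdge.Birth

open Filter Topology
open Literature.MathematicalPhysics.QuantumFieldTheory
open Summit.QuantumFields.QCD.Theses.FemtoStepScaling

/-! ## §0 Folding the crux (definitional abbreviations of its own clauses) -/

/-- The crux's standing hypotheses on the regularisation: leading-log mass scaling, two-loop asymptotic scaling,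
`m_crit(k) > −1` eventually (verbatim). -/
def Good (Nf : ℕ) (reg : QCDRegularisation Nf) : Prop :=
  reg.HasMassScaling ∧ (∃ Λ > 0, Tendsto (fun k => reg.β k - afBeta Nf Λ (reg.a k)) atTop (nhds 0)) ∧
    (∀ᶠ k in atTop, (-1 : ℝ) < reg.mcrit k)

/-- **Box mixing at precision `ε` and physical scale `ℓ`** at the tuple `m` — the crux's inner clause VERBATIM:
eventually in `k`, on the hypercubic torus of side `2⌊ℓ/(2a_k)⌋+1` at `(β_k, m_f(k))`, the `(−1)^F`-twisted partition
function is non-zero and every pair `A, B` of sup-normalised gluonic cylinder observables supported in the time-slab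
`[0, ℓ/8]` has covariance `≤ ε` between `A` and `B` translated by half the box. -/
def MixAt {Nf : ℕ} (reg : QCDRegularisation Nf) (m : Fin Nf → ℝ) (ε ℓ : ℝ) : Prop :=
  ∀ᶠ k in atTop, ∀ S : ℕ, S = ⌊ℓ / (2 * reg.a k)⌋₊ → (∫ U, fermiIntegral (fermiBoltzmann U (fun fl => (reg.scheme m 0 0).mq fl k)) ∂(wilsonMeasure (d := 4) (L := (2 * S + 1)) (Literature.MathematicalPhysics.QuantumLattice.fundamentalRep (Fin 3)) (reg.β k))) ≠ 0 ∧ ∀ Ex : (GaugeConfig 4 (2 * S + 1) (Matrix.specialUnitaryGroup (Fin 3) ℂ) → FermiAlg Nf (2 * S + 1)) → ℂ, Ex = qcdTorusExpect (reg.β k) (2 * S + 1) (fun fl => (reg.scheme m 0 0).mq fl k) → ∀ ι : ℝ → FermiAlg Nf (2 * S + 1), ι = (fun r : ℝ => algebraMap ℂ _ (r : ℂ)) → ∀ InSlab : YMSpecies (Matrix.specialUnitaryGroup (Fin 3) ℂ) → Prop, InSlab = (fun A => (∀ U, |A.F U| ≤ 1) ∧ (∀ e ∈ A.supp, (0 :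 ℤ) ≤ e.1 0 ∧ (8 : ℝ) * ((e.1 0 : ℤ) : ℝ) * reg.a k ≤ ℓ)) → ∀ A B : YMSpecies (Matrix.specialUnitaryGroup (Fin 3) ℂ), InSlab A → InSlab B → ‖(Ex (fun U => ι (A.F (Literature.MathematicalPhysics.QuantumLattice.torusLift (2 * S + 1) U)) * ι (B.F (Literature.MathematicalPhysics.QuantumLattice.configShift (-(Pi.single (0 : Fin 4) ((S : ℕ) : ℤ))) (Literature.MathematicalPhysics.QuantumLattice.torusLift (2 * S + 1) U)))) - Ex (fun U => ι (A.F (Literature.MathematicalPhysics.QuantumLattice.torusLift (2 * S + 1) U))) * Ex (fun U => ι (B.F (Literature.MathematicalPhysics.QuantumLattice.configShift (-(Pi.single (0 : Fin 4) ((S : ℕ) : ℤ))) (Literature.MathematicalPhysics.QuantumLattice.torusLift (2 * S + 1) U)))))‖ ≤ ε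

/-- **Box mixing DECAYS at the tuple `m`**: every precision is reached at some physical scale (verbatim the per-tuple
conclusion of `BoxMixingDecayR` and of the crux's clause (a)). -/
def Mixes {Nf : ℕ} (reg : QCDRegularisation Nf) (m : Fin Nf → ℝ) : Prop :=
  ∀ ε > 0, ∃ ℓ > 0, MixAt reg m ε ℓ

/-- **`M` is a mixing threshold**: box mixing decays for every tuple all of whose masses lie strictly above `M`. -/
def InT {Nf : ℕ} (reg : QCDRegularisation Nf) (M : ℝ) : Prop :=
  ∀ m : Fin Nf → ℝ, (∀ fl, M < m fl) → Mixes reg m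

/-- **Level `M` is gapless from above**: for every rate some tuple strictly above `M` has no uniform lattice gap at
that rate (at `M = 0` this is `reg.IsChiralAtZero`, `Iff.rfl`). -/
def GaplessAbove {Nf : ℕ} (reg : QCDRegularisation Nf) (M : ℝ) : Prop :=
  ∀ ε > 0, ∃ m : Fin Nf → ℝ, (∀ fl, M < m fl) ∧ ¬ (reg.scheme m 0 0).HasLatticeMassGap ε

/-- The crux, folded — DEFINITIONAL (`Iff.rfl`): nothing is restated. [folklore] -/
theorem sharpChiralEdge_iff :
    SharpChiralEdge ↔
      ∀ (Nf : ℕ) (reg : QCDRegularisation Nf), 2 ≤ Nf → Nf ≤ 3 → Good Nf reg → reg.IsChiralAtZero →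
        (∃ M₀ : ℝ, InT reg M₀) → ∃ Mχ : ℝ, 0 ≤ Mχ ∧ InT reg Mχ ∧ GaplessAbove reg Mχ :=
  Iff.rfl

/-- `IsChiralAtZero` is gaplessness from above at level `0` (definitional). [folklore] -/
theorem isChiralAtZero_iff_gaplessAbove_zero {Nf : ℕ} (reg : QCDRegularisation Nf) :
    reg.IsChiralAtZero ↔ GaplessAbove reg 0 :=
  Iff.rfl

/-! ## §1 The three stub statements -/

/-- **(S1) The dictionary: a uniform gap drives box mixing at a common scale** (size L).  For `N_f ∈ {2,3}`, a good
regularisation, a level `M ≥ 0` and a rate `δ > 0`: IF every tuple of the orthant above `M` has the uniform lattice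
gap `δ` (`HasLatticeMassGap`, all gauge-invariant local observables, tori `S ≥ L_k`), THEN for every precision `ε > 0`
there is ONE physical scale `ℓ > 0` at which every tuple of the orthant box-mixes to precision `ε` (`MixAt`:
twisted partition function `≠ 0` and sup-normalised half-box slab covariance `≤ ε`, eventually in `k`).  Why plausibly
true: gap `δ` ⇒ vacuum-to-vacuum covariance `≤ 2e^{−3δℓ/8}` by the spectral projection (no entropy factor), thermal
`(−1)^F` corrections `O((δℓ)^{3/2} e^{−δℓ})`, `Z^{tw} > 0` by vacuum dominance, all uniform on the orthant because the
rate is.  Why it might fail: the hypothesis lives on tori of physical size `a_k(2L_k+1) → ∞`, the conclusion on the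
torus of FIXED side `≈ ℓ` — needs a cutoff-uniform finite-volume (Lüscher 1986-type) transfer for Wilson quarks under a
signed determinant, and a cutoff-uniform density of low-lying states; neither is in print. -/
def GapDrivesMixingStmt : Prop :=
  ∀ (Nf : ℕ) (reg : QCDRegularisation Nf), 2 ≤ Nf → Nf ≤ 3 → Good Nf reg →
    ∀ M : ℝ, 0 ≤ M → ∀ δ > 0,
      (∀ m : Fin Nf → ℝ, (∀ fl, M < m fl) → (reg.scheme m 0 0).HasLatticeMassGap δ) →
        ∀ ε > 0, ∃ ℓ > 0, ∀ m : Fin Nf → ℝ, (∀ fl, M < m fl) → MixAt reg m ε ℓ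

/-- **(S2) Openness in the renormalised mass at fixed scale, inside the uniformly gapped regime** (size M/L; carries
the crux's bet "no non-chiral obstruction").  For `N_f ∈ {2,3}`, a good regularisation and a level `M > 0` above which
the lattice gap is uniform: IF at some FIXED physical scale `ℓ` every tuple of the orthant above `M` box-mixes to
precision `ε/2`, THEN every tuple of the orthant above some STRICTLY LOWER level `M' < M` box-mixes to precision `ε` at
the same scale.  Why plausibly true: at fixed physical volume `≈ ℓ⁴` the twisted expectations are `k`-uniformly
equicontinuous in the renormalised masses (mass derivatives = volume-integrated insertions of the renormalised scalar
density, finite because `Z_S Z_m = 1`; heavy spectators decouple), and a uniform gap above `M` puts `M` strictly above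
the chiral point of `reg`, so the new tuples are still massive theories; `Z^{tw} ≠ 0` persists by vacuum dominance.
Why it might fail: a FIRST-ORDER WALL in `m` inside the massive regime (coexistence in the `ℓ`-box at the wall tuple
makes the sup-covariance `O(1)`) — the route's kill criterion for this crux; zeros of the `(−1)^F` partition function at
tuples just below `M` with arbitrarily heavy spectators; loss of `k`-uniformity of the mass modulus. -/
def FixedScaleOpennessStmt : Prop :=
  ∀ (Nf : ℕ) (reg : QCDRegularisation Nf), 2 ≤ Nf → Nf ≤ 3 → Good Nf reg →
    ∀ M : ℝ, 0 < M →
      (∃ δ > 0, ∀ m : Fin Nf → ℝ, (∀ fl, M < m fl) → (reg.scheme m 0 0).HasLatticeMassGap δ) →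
        ∀ ε > 0, ∀ ℓ > 0, (∀ m : Fin Nf → ℝ, (∀ fl, M < m fl) → MixAt reg m (ε / 2) ℓ) →
          ∃ M' < M, ∀ m : Fin Nf → ℝ, (∀ fl, M' < m fl) → MixAt reg m ε ℓ

/-- **(S3) Threshold bootstrap for box mixing** (size XL / open; a cutoff-uniform finite-size criterion).  For
`N_f ∈ {2,3}` and a good regularisation there is a threshold `ε₀ > 0` such that for every POSITIVE tuple `m`: IF `m`
box-mixes below `ε₀` at ONE physical scale, THEN box mixing decays at `m` (every precision at some scale).  Why
plausibly true: in a massive theory mixing improves with the scale (Dobrushin–Shlosman / Martinelli–Olivieri: a mixing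
condition verified on one scale propagates), while at a gapless, scale-invariant tuple the sup-normalised half-box
slab covariance is a scale-independent constant, so `ε₀` below it makes the hypothesis void there.  Why it might fail:
known finite-size criteria are lattice-scale with entropy factors `(ℓ/a)³` diverging as `a → 0`; cutoff-uniformity
needs an RG step inside the criterion (the same obstruction as the route's `PhysicalFiniteSizeCriterionR`); slow
(polynomial) crossovers near the chiral point could defeat a UNIFORM threshold. -/
def ThresholdBootstrapStmt : Prop :=
  ∀ (Nf : ℕ) (reg : QCDRegularisation Nf), 2 ≤ Nf → Nf ≤ 3 → Good Nf reg →
    ∃ ε₀ > 0, ∀ m : Fin Nf → ℝ, (∀ fl, 0 < m fl) → (∃ ℓ > 0, MixAt reg m ε₀ ℓ) → Mixes reg m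

/-! ## §2 The registered stubs (the ONLY `sorry`s of this file) -/

/-- (S1) the dictionary: uniform gap ⇒ common-scale box mixing — size L. -/
theorem stub_gapDrivesMixing : GapDrivesMixingStmt := by
  sorry

/-- (S2) openness in the renormalised mass at fixed scale — size M/L, carries the no-wall bet. -/
theorem stub_fixedScaleOpenness : FixedScaleOpennessStmt := by
  sorry

/-- (S3) threshold bootstrap — size XL / open. -/
theorem stub_thresholdBootstrap : ThresholdBootstrapStmt := by
  sorry

/-! ## §3 Order-theoretic glue (sorry-free): the threshold set is an up-set containing its infimum -/

variable {Nf : ℕ}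

/-- A tuple strictly above a level is strictly above some strictly higher level (finitely many flavours, `N_f ≥ 1`).
[folklore] -/
theorem exists_level_between (hNf : 2 ≤ Nf) (m : Fin Nf → ℝ) (M : ℝ) (hm : ∀ fl, M < m fl) :
    ∃ M' : ℝ, M < M' ∧ ∀ fl, M' < m fl := by
  haveI : Nonempty (Fin Nf) := ⟨⟨0, by omega⟩⟩
  obtain ⟨fl₀, hfl₀⟩ := Finite.exists_min m
  refine ⟨(M + m fl₀) / 2, ?_, fun fl => ?_⟩
  · have := hm fl₀
    linarith
  · have h1 := hm fl₀
    have h2 := hfl₀ fl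
    linarith

/-- Thresholds form an up-set. [folklore] -/
theorem InT.mono {reg : QCDRegularisation Nf} {M M' : ℝ} (h : InT reg M) (hle : M ≤ M') : InT reg M' :=
  fun m hm => h m fun fl => lt_of_le_of_lt hle (hm fl)

/-- A non-empty set of thresholds contains its (conditional) infimum: a tuple strictly above `inf T` is strictly above
some element of `T` (for `T` unbounded below `sInf T` is a junk real and the statement still holds). [folklore] -/
theorem inT_csInf (hNf : 2 ≤ Nf) {reg : QCDRegularisation Nf} {T : Set ℝ} (hT : ∀ M ∈ T, InT reg M)
    (hne : T.Nonempty) : InT reg (sInf T) := by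
  intro m hm
  obtain ⟨M', hM', hM'm⟩ := exists_level_between hNf m (sInf T) hm
  obtain ⟨M'', hM''T, hM''lt⟩ := exists_lt_of_csInf_lt hne hM'
  exact hT M'' hM''T m fun fl => hM''lt.trans (hM'm fl)

/-! ## §4 Composition (kernel-checked; no `sorry` below this line) -/

/-- **No gapped wall** — the three stubs chained: a level `M > 0` above which the lattice gap is uniform lies
STRICTLY inside the mixing region.  Dictionary at precision `ε₀/2` (common scale `ℓ` on the orthant above `M`) ⇒
openness at precision `ε₀` (orthant above some `M' < M`, same scale) ⇒ bootstrap on the orthant above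
`max M' 0 < M` (positive tuples, below threshold at one scale ⇒ decay). -/
theorem noGappedWall_of (h1 : GapDrivesMixingStmt) (h2 : FixedScaleOpennessStmt) (h3 : ThresholdBootstrapStmt)
    (reg : QCDRegularisation Nf) (h2le : 2 ≤ Nf) (hle3 : Nf ≤ 3) (hgood : Good Nf reg)
    {M : ℝ} (hM : 0 < M)
    (hgap : ∃ δ > 0, ∀ m : Fin Nf → ℝ, (∀ fl, M < m fl) → (reg.scheme m 0 0).HasLatticeMassGap δ) :
    ∃ M' : ℝ, M' < M ∧ InT reg M' := by
  obtain ⟨ε₀, hε₀, hboot⟩ := h3 Nf reg h2le hle3 hgood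
  obtain ⟨δ, hδ, hgapδ⟩ := hgap
  -- (S1) at level `M`, rate `δ`, precision `ε₀ / 2`: one common scale `ℓ`
  obtain ⟨ℓ, hℓ, hmixM⟩ := h1 Nf reg h2le hle3 hgood M hM.le δ hδ hgapδ (ε₀ / 2) (half_pos hε₀)
  -- (S2) at level `M`, precision `ε₀`, scale `ℓ`: a strictly lower level `M'`
  obtain ⟨M', hM'lt, hmixM'⟩ := h2 Nf reg h2le hle3 hgood M hM ⟨δ, hδ, hgapδ⟩ ε₀ hε₀ ℓ hℓ hmixM
  -- (S3) on the positive part of the new orthant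
  refine ⟨max M' 0, max_lt hM'lt hM, fun m hm => ?_⟩
  have hpos : ∀ fl, 0 < m fl := fun fl => lt_of_le_of_lt (le_max_right _ _) (hm fl)
  have hM'm : ∀ fl, M' < m fl := fun fl => lt_of_le_of_lt (le_max_left _ _) (hm fl)
  exact hboot m hpos ⟨ℓ, hℓ, hmixM' m hM'm⟩

/-- **The crux from the three stubs** (concludes `SharpChiralEdge` BY NAME).  Let `T` be the set of mixing
thresholds of `reg`; it is non-empty by the ladder hypothesis `∃ M₀`.  EITHER every positive level is in `T`: then
`Mχ := 0`, clause (a) because a tuple with positive masses is above some positive level, clause (b) is the hypothesis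
`reg.IsChiralAtZero` itself.  OR some positive level `M₁` is not: then `T ⊆ [M₁, ∞)` (up-set), `Mχ := inf T > 0` is a
threshold (§3), and it is gapless from above — otherwise the gap is uniform on the orthant above `Mχ` at some rate and
`noGappedWall_of` produces a threshold strictly below `inf T`. -/
theorem SharpChiralEdge_of :
    GapDrivesMixingStmt → FixedScaleOpennessStmt → ThresholdBootstrapStmt →
      Summit.QuantumFields.QCD.Theses.FemtoStepScaling.SharpChiralEdge := by
  intro h1 h2 h3
  rw [sharpChiralEdge_iff]
  intro Nf reg h2le hle3 hgood hchi hmix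
  obtain ⟨M₀, hM₀⟩ := hmix
  by_cases hall : ∀ M : ℝ, 0 < M → InT reg M
  · -- every positive level is a threshold: the edge is the chiral point `0` of the Statement's own clause
    refine ⟨0, le_rfl, fun m hm => ?_, (isChiralAtZero_iff_gaplessAbove_zero reg).1 hchi⟩
    obtain ⟨M', hM'0, hM'm⟩ := exists_level_between h2le m 0 hm
    exact hall M' hM'0 m hM'm
  · -- a positive non-threshold `M₁`: the edge is `inf T ≥ M₁ > 0`
    push Not at hall
    obtain ⟨M₁, hM₁, hnot⟩ := hall
    set T : Set ℝ := {M | InT reg M} with hTdef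
    have hT : ∀ M ∈ T, InT reg M := fun M hM => hM
    have hne : T.Nonempty := ⟨M₀, hM₀⟩
    have hlb : ∀ M ∈ T, M₁ ≤ M := by
      intro M hM
      by_contra hlt
      push Not at hlt
      exact hnot ((hT M hM).mono hlt.le)
    have hbdd : BddBelow T := ⟨M₁, hlb⟩
    have hMχ₁ : M₁ ≤ sInf T := le_csInf hne hlb
    have hMχpos : 0 < sInf T := hM₁.trans_le hMχ₁
    have hMχT : InT reg (sInf T) := inT_csInf h2le hT hne
    refine ⟨sInf T, hMχpos.le, hMχT, fun ε hε => ?_⟩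
    by_contra hcon
    push Not at hcon
    -- `hcon`: the gap is uniform at rate `ε` on the orthant above `inf T` — a gapped wall
    obtain ⟨M', hM'lt, hM'T⟩ := noGappedWall_of h1 h2 h3 reg h2le hle3 hgood hMχpos ⟨ε, hε, hcon⟩
    have hle : sInf T ≤ M' := csInf_le hbdd hM'T
    exact absurd hM'lt (not_lt.mpr hle)

/-- The crux along this skeleton, from the registered stubs (sorries only inside `stub_*`). -/
theorem sharpChiralEdge_of_stubs : Summit.QuantumFields.QCD.Theses.FemtoStepScaling.SharpChiralEdge :=
  SharpChiralEdge_of stub_gapDrivesMixing stub_fixedScaleOpenness stub_thresholdBootstrap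

end Summit.QuantumFields.QCD.Cruxes.SharpChiralEdge.Birth

end
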